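import Mathlib
import Literature.Analysis.FluidPDE.SuitableWeak
import Literature.Analysis.FluidPDE.WeakSolution
import Literature.Analysis.FluidPDE.Seregin2023.TypeIIEulerZoom
import Literature.Analysis.FluidPDE.AxisymmetricEuler
import HarnessLib.Audit

/-!
# Rung C (IN-WINDOW, plan-only) of the crux `EulerZoomLiouville.PowerGaugeEulerLiouville`

Tenure-at-birth addition (planner-ns-plan-lens-oqh-typeII-g2-0, 2026-08-26), answering critic-2's
K-READ 01 birth condition (b): «a FIRST IN-WINDOW RUNG typed … so progress is measurable before
E-whole; order of preference (i) E restricted to exact self-similar members …, (ii) DSS / log-periodic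
members, (iii) axisymmetric-no-swirl members». Rungs A (`ρ > 1/2`, energy-gaining) and B (steady
members: large-scale arithmetic of the enstrophy weight) do NOT exercise the lever inside the window
`0 < ρ ≤ 1/2`; the three signatures below do. Each is a literal SUB-CASE of the crux
(`rungC*_of_crux` below, kernel-checked), hence strictly inside E and never summit-strength.

Dictionary (checked against K-READ 01 §K2/K3): a self-similar member of Seregin's power-gauged class
with exponent `ρ` is `u(τ,y) = (−τ)^{−m} V(y (−τ)^{−n})`, `p(τ,y) = (−τ)^{−2m} P(y (−τ)^{−n})` with
  `n = 1/(2+ρ)` (length exponent), `m = (1+ρ)/(2+ρ) = 1 − n` (amplitude exponent);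
window `0 < ρ ≤ 1/2` ⟺ `n ∈ [2/5, 1/2)` ⟺ Chae–Shvydkoy `α = 1/n − 1 = 1+ρ ∈ (1, 3/2]`
⟺ Constantin–Ignatova–Vicol `γ = n ∈ [2/5, 1/2)` («below the parabolic threshold»).
The class is invariant under the scalings `(S_l u)(τ,y) = l^{1+ρ} u(l^{2+ρ} τ, l y)`, `l > 0`;
self-similar = fixed by every `S_l`, DSS = fixed by one `S_l`, `l > 1`.

PRINTED SUB-CASES (what a prover can port first; none covers the rung whole):
* [CS13] Chae–Shvydkoy, ARMA 209 (2013) = arXiv:1201.6009: Thm 3.2 (p.7) `V ∈ Lᵖ ∩ C¹_loc`,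
  `3 ≤ p ≤ ∞`, `−1 < α ≤ 3/p` or `α > 3/2` ⇒ `V = 0` — this MISSES the window (for `p ≥ 3`,
  `3/p ≤ 1 < α`); p.4: «it is precisely for N/p < α ≤ N/2 when this algorithm fails to bootstrap» —
  the rung IS that window; Thm 3.1 (p.7): the endpoint `α = 3/2` (`ρ = 1/2`, energy-conserving) is
  excluded for `V ∈ L² ∩ C¹_loc` under two-sided power bounds `c|y|^{−(4−δ)} ≤ |V| ≤ C|y|^{1−δ}`;
  Thm 4.1 (p.10): vorticity profile `Ω ∈ L^q` for some `0 < q < 3/(1+α) = 3/(2+ρ)` (+ (i)) ⇒ `V`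
  irrotational ⇒ trivial.
* [BS14] Bronzi–Shvydkoy arXiv:1310.8611 Thm 1.1: a profile in the window is trivial OR its energy
  measure concentrates on a set of dimension exactly `N − 2`.
* [CIV26] Constantin–Ignatova–Vicol arXiv:2602.17570 (Feb 2026): Thm 3.8 / Prop 3.9 / Thm 3.10
  (pp.10–12): a `C²` globally self-similar Euler profile with the LOCAL OUTGOING PROPERTY (Def 3.7) at
  the (finite) nodal set of `V(y)·… = γ y + U(y)` and real-analytic there has `γ ≥ 1/2` — i.e. NO
  outgoing member in the window; Thm 2.1 + Rem 2.2 (p.5): finite energy alone forces `γ ≥ 2/5`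
  (the window's left end); §4 (pp.13–14): axisymmetric profiles — nonzero swirl at a stagnation point
  of the self-similar Lagrangian flow ⇒ `γ = 1/2` (not in the window); `C¹` near all stagnation points,
  all on the axis ⇒ `γ ≥ 1/2`. Open residue stated by the authors (p.3 L33–38, p.10 §3.5 «A priori,
  we cannot rule out the existence of points y ≠ 0 for which V(y) = 0»): the window WITHOUT the
  outgoing property — exactly `Sig.rungC1_selfSimilar` below.
So: C1 ⊋ print (open: Chae's window without decay/outgoing hypotheses); C2 (DSS) ⊋ C1; C3 (axisym
no swirl, any time dependence) is independent of C1/C2 and has NO print inside the window for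
non-self-similar members. Suggested first prover target: C1 at the endpoint `ρ = 1/2` (port CS13
Thm 3.1, then remove its lower power bound using the class's pressure gauge `a^{2ρ} D(a) ≤ c`).
-/

open MeasureTheory Set Filter Topology Metric
open scoped ENNReal NNReal

namespace Summit.NavierStokesRegularity.NavierStokesRegularity.Cruxes.PowerGaugeEulerLiouville.RungC

/-- Local abbreviation: ℝ³. -/
abbrev E3 : Type := EuclideanSpace ℝ (Fin 3)

/-- `(u,p,H)` is an ancient local-energy Euler flow on `ℝ³ × (−∞,0)` in Seregin's power-gauged class
with exponent `ρ` and constant `c` — verbatim the three hypotheses of the crux (copied from the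
birth skeleton `Lines/birth.lean`, `InClass`). -/
@[reducible] def InClass (ρ : ℝ) (u : ℝ → E3 → E3) (p : ℝ → E3 → ℝ) (H : ℝ → E3 → E3 →L[ℝ] E3)
    (c : ℝ≥0) : Prop :=
  Literature.Analysis.FluidPDE.IsSuitableWeakSolutionOn
      (Literature.Analysis.FluidPDE.slab (EuclideanSpace ℝ (Fin 3)) (Set.Iio 0) isOpen_Iio) 0 0 u p ∧
    Literature.Analysis.FluidPDE.HasWeakSpatialGradientOn
      (Literature.Analysis.FluidPDE.slab (EuclideanSpace ℝ (Fin 3)) (Set.Iio 0) isOpen_Iio) u H ∧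
    (∀ a : ℝ, 0 < a →
      ENNReal.ofReal (a ^ (2 * ρ)) * Literature.Analysis.FluidPDE.cknA a (0 : ℝ × E3) u +
          ENNReal.ofReal (a ^ ρ) * Literature.Analysis.FluidPDE.cknE a (0 : ℝ × E3) H +
        ENNReal.ofReal (a ^ (2 * ρ)) * Literature.Analysis.FluidPDE.cknD a (0 : ℝ × E3) p ≤ (c : ℝ≥0∞))

/-- The a.e.-vanishing conclusion of the crux on the slab `(−∞,0) × ℝ³`. -/
@[reducible] def VanishesAE (u : ℝ → E3 → E3) : Prop :=
  Function.uncurry u =ᵐ[volume.restrict (Set.Iio (0 : ℝ) ×ˢ (Set.univ : Set E3))] 0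

/-- The crux, restated verbatim (= `EulerZoomLiouville.PowerGaugeEulerLiouville`; same text as
`Lines/birth.lean`'s `Crux`). -/
def Crux : Prop :=
  ∀ ρ : ℝ, 0 < ρ → ∀ (u : ℝ → E3 → E3) (p : ℝ → E3 → ℝ) (H : ℝ → E3 → E3 →L[ℝ] E3) (c : ℝ≥0),
    InClass ρ u p H c → VanishesAE u

/-- `u, p` are EXACTLY SELF-SIMILAR with the class exponents: `u(τ,y) = (−τ)^{−m} V((−τ)^{−n} y)`,
`p(τ,y) = (−τ)^{−2m} P((−τ)^{−n} y)`, `n = 1/(2+ρ)`, `m = (1+ρ)/(2+ρ)`, for `τ < 0`. -/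
@[reducible] def IsSelfSimilarPair (ρ : ℝ) (u : ℝ → E3 → E3) (p : ℝ → E3 → ℝ)
    (V : E3 → E3) (P : E3 → ℝ) : Prop :=
  (∀ τ : ℝ, τ < 0 → ∀ y : E3,
      u τ y = ((-τ) ^ (-((1 + ρ) / (2 + ρ)))) • V (((-τ) ^ (-(1 / (2 + ρ)))) • y)) ∧
    (∀ τ : ℝ, τ < 0 → ∀ y : E3,
      p τ y = ((-τ) ^ (-(2 * (1 + ρ) / (2 + ρ)))) * P (((-τ) ^ (-(1 / (2 + ρ)))) • y))

/-- `u, p` are DISCRETELY SELF-SIMILAR with factor `l > 1` for the class scaling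
`(S_l u)(τ,y) = l^{1+ρ} u(l^{2+ρ} τ, l y)`, `(S_l p)(τ,y) = l^{2(1+ρ)} p(l^{2+ρ} τ, l y)`. -/
@[reducible] def IsDSSPair (ρ : ℝ) (u : ℝ → E3 → E3) (p : ℝ → E3 → ℝ) (l : ℝ) : Prop :=
  1 < l ∧
    (∀ τ : ℝ, τ < 0 → ∀ y : E3, u τ y = (l ^ (1 + ρ)) • u ((l ^ (2 + ρ)) * τ) (l • y)) ∧
    (∀ τ : ℝ, τ < 0 → ∀ y : E3, p τ y = (l ^ (2 * (1 + ρ))) * p ((l ^ (2 + ρ)) * τ) (l • y))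

/-- RUNG C1 (critic's (i)): in the window `0 < ρ ≤ 1/2`, every EXACTLY SELF-SIMILAR member of the
class vanishes. Open in print as typed (Chae–Shvydkoy window `1 < α ≤ 3/2` without Lᵖ-decay, CIV26
without the outgoing property); printed sub-cases listed in the module docstring. -/
def Sig.rungC1_selfSimilar : Prop :=
  ∀ ρ : ℝ, 0 < ρ → ρ ≤ 1 / 2 →
    ∀ (u : ℝ → E3 → E3) (p : ℝ → E3 → ℝ) (H : ℝ → E3 → E3 →L[ℝ] E3) (c : ℝ≥0)
      (V : E3 → E3) (P : E3 → ℝ),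
      InClass ρ u p H c → IsSelfSimilarPair ρ u p V P → VanishesAE u

/-- RUNG C2 (critic's (ii)): in the window, every DISCRETELY SELF-SIMILAR member vanishes
(log-periodic Euler collapse excluded). Contains C1. No print inside the window. -/
def Sig.rungC2_dss : Prop :=
  ∀ ρ : ℝ, 0 < ρ → ρ ≤ 1 / 2 →
    ∀ (u : ℝ → E3 → E3) (p : ℝ → E3 → ℝ) (H : ℝ → E3 → E3 →L[ℝ] E3) (c : ℝ≥0) (l : ℝ),
      InClass ρ u p H c → IsDSSPair ρ u p l → VanishesAE u

/-- RUNG C3 (critic's (iii)): in the window, every member that is AXISYMMETRIC WITHOUT SWIRL at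
every time vanishes (tree predicates `IsAxisymmetric`, `HasNoSwirl` of `AxisymmetricEuler`). -/
def Sig.rungC3_axisymNoSwirl : Prop :=
  ∀ ρ : ℝ, 0 < ρ → ρ ≤ 1 / 2 →
    ∀ (u : ℝ → E3 → E3) (p : ℝ → E3 → ℝ) (H : ℝ → E3 → E3 →L[ℝ] E3) (c : ℝ≥0),
      InClass ρ u p H c →
        (∀ τ : ℝ, τ < 0 → Literature.Analysis.FluidPDE.IsAxisymmetric (u τ) ∧
            Literature.Analysis.FluidPDE.HasNoSwirl (u τ)) →
          VanishesAE u

/-- C1 is a literal sub-case of the crux (so it is strictly inside E, never summit-strength). -/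
theorem rungC1_of_crux : Crux → Sig.rungC1_selfSimilar :=
  fun h ρ hρ _ u p H c _ _ hcl _ => h ρ hρ u p H c hcl

/-- C2 is a literal sub-case of the crux. -/
theorem rungC2_of_crux : Crux → Sig.rungC2_dss :=
  fun h ρ hρ _ u p H c _ hcl _ => h ρ hρ u p H c hcl

/-- C3 is a literal sub-case of the crux. -/
theorem rungC3_of_crux : Crux → Sig.rungC3_axisymNoSwirl :=
  fun h ρ hρ _ u p H c hcl _ => h ρ hρ u p H c hcl

/-- PLAN-ONLY STUB (first prover target inside the window): rung C1. Technique: port the profile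
local-energy bootstrap of [CS13] §3 at the endpoint `ρ = 1/2` first (Thm 3.1), replacing its lower
power bound by the class's pressure gauge; then the interior of the window is Chae's open range. -/
theorem rungC1_selfSimilar : Sig.rungC1_selfSimilar := by
  sorry

/-- PLAN-ONLY STUB: rung C2 (DSS members). -/
theorem rungC2_dss : Sig.rungC2_dss := by
  sorry

/-- PLAN-ONLY STUB: rung C3 (axisymmetric no-swirl members). -/
theorem rungC3_axisymNoSwirl : Sig.rungC3_axisymNoSwirl := by
  sorry

end Summit.NavierStokesRegularity.NavierStokesRegularity.Cruxes.PowerGaugeEulerLiouville.RungC
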